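import Literature.Probability.RandomPlanarGeometry.PlanarDomains
import Literature.Probability.LatticeModels.TriangularLatticeProofs
import Literature.Probability.Percolation.SiteNestingWeightBound
import Literature.Probability.Percolation.TriApproxDomain
import HarnessLib

/-!
# The face-centre grid of `δ𝕋` in a conformal rectangle (stub `stub_voronoiGrid` of line `Sketch`)

Helper file for the crux `Target` (stmt-CriticalPhenomena-6431) of route `CardyFlipRusso`
(sub-problem `CardyFormulaZ2`), line `Sketch`: the registered stub `stub_voronoiGrid` — pure
lattice geometry, no percolation.

Let `R = (Ω; a', b', c', d')` be a conformal rectangle. For a mesh `δ > 0` let `S_δ` be the set of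
centres `δ · hexCenter F` of the faces `F` of the rescaled triangular lattice `δ𝕋` that lie in
`closure Ω` (and `S_δ = ∅` for `δ ≤ 0`). Then

* `S_δ` is finite (`closure Ω` is bounded and only finitely many faces have rescaled centre in a
  given ball, `finite_setOf_norm_hexCenter_le`), `S_δ ⊆ closure Ω`, and `S_δ` contains every face
  centre of `δ𝕋` lying in `closure Ω`;
* `S_δ` is eventually `ε(δ)`-dense in `closure Ω` with `ε(δ) → 0` as `δ → 0⁺`: for every `η > 0`
  cover the compact set `closure Ω` by finitely many balls `B(y_k, η/2)` with `y_k ∈ Ω`, choose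
  `r > 0` with `B̄(y_k, r) ⊆ Ω` for all `k`; the face centres of `δ𝕋` are `3δ`-dense in the plane
  (`exists_site_dist_le`, `dist_triMeshPoint_hexCenter_le`), so for `3δ ≤ min r (η/2)` every
  `z ∈ closure Ω` is within `η` of a face centre lying in some `B̄(y_k, r) ⊆ Ω ⊆ closure Ω`; the
  passage from "for every `η`, eventually" to "eventually, at rate `ε(δ) → 0`" is the infimum trick.

This is the carrier of Bollobás–Riordan's discrete separating data ((31)/(34), pp. 196–197) for
the annealed Voronoi model read on the auxiliary lattice `δ𝕋`.

## References

* B. Bollobás, O. Riordan, *Percolation*, Cambridge University Press (2006), Ch. 7, §7.2,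
  pp. 196–197 (the grid of the discrete separating probabilities).
-/

noncomputable section

namespace Summit.CriticalPhenomena.CardyFormulaZ2.Theorems.CardyFlipRussoTarget

open Filter Set Metric
open scoped Topology
open Literature.Probability.RandomPlanarGeometry
open Literature.Probability.LatticeModels
open Literature.Probability.Percolation

/-- **The infimum trick.** If a property of `(δ, η)` holds, for every `η > 0`, at all small
`δ > 0`, then there is a choice `ε δ → 0⁺` with the property at `(δ, ε δ)` for all small `δ`
(proof copied from `CardySusyWardDiscretisationFamilyExists.exists_tendsto_of_forall_eventually`).
[folklore] -/
private theorem exists_tendsto_of_forall_eventually {P : ℝ → ℝ → Prop}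
    (h : ∀ η : ℝ, 0 < η → ∀ᶠ δ in 𝓝[>] (0 : ℝ), P δ η) :
    ∃ ε : ℝ → ℝ, Tendsto ε (𝓝[>] 0) (𝓝 0) ∧ ∀ᶠ δ in 𝓝[>] (0 : ℝ), 0 < ε δ ∧ P δ (ε δ) := by
  classical
  set G : ℝ → Set ℝ := fun δ => {η | 0 < η ∧ P δ η} with hG
  have hbdd : ∀ δ, BddBelow (G δ) := fun δ => ⟨0, fun η hη => hη.1.le⟩
  set ε : ℝ → ℝ := fun δ =>
    if hx : ∃ η, η ∈ G δ ∧ η < sInf (G δ) + δ then Classical.choose hx else 1 with hε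
  have hmem : ∀ η : ℝ, 0 < η → ∀ᶠ δ in 𝓝[>] (0 : ℝ), η ∈ G δ := fun η hη =>
    (h η hη).mono fun δ hδ => ⟨hη, hδ⟩
  have hpos : ∀ᶠ δ in 𝓝[>] (0 : ℝ), 0 < δ := self_mem_nhdsWithin
  -- the choice is made, eventually
  have hchoice : ∀ᶠ δ in 𝓝[>] (0 : ℝ), ε δ ∈ G δ ∧ ε δ < sInf (G δ) + δ := by
    filter_upwards [hmem 1 one_pos, hpos] with δ h1 hδ
    have hx : ∃ η, η ∈ G δ ∧ η < sInf (G δ) + δ := by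
      obtain ⟨η, hη, hlt⟩ := exists_lt_of_csInf_lt ⟨1, h1⟩ (lt_add_of_pos_right _ hδ)
      exact ⟨η, hη, hlt⟩
    have : ε δ = Classical.choose hx := by rw [hε]; exact dif_pos hx
    rw [this]
    exact Classical.choose_spec hx
  refine ⟨ε, ?_, hchoice.mono fun δ hδ => ⟨hδ.1.1, hδ.1.2⟩⟩
  rw [Metric.tendsto_nhds]
  intro e he
  filter_upwards [hchoice, hmem (e / 2) (by positivity),
    Ioo_mem_nhdsGT (show (0 : ℝ) < e / 2 by positivity)] with δ hc h2 hδ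
  have hinf : sInf (G δ) ≤ e / 2 := csInf_le (hbdd δ) h2
  rw [Real.dist_eq, sub_zero, abs_of_pos hc.1.1]
  linarith [hc.2, hδ.2]

/-- **The face centres of `δ𝕋` are `3δ`-dense in the plane** (`δ > 0`): every point is within `2δ`
of a site (`exists_site_dist_le`) and a site is within `δ` of the centre of its up face
(`dist_triMeshPoint_hexCenter_le`). [folklore] -/
private theorem exists_hexCenter_dist_le (y : ℂ) {δ : ℝ} (hδ : 0 < δ) :
    ∃ F : HexVertex, dist ((δ : ℂ) * hexCenter F) y ≤ 3 * δ := by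
  obtain ⟨x, hx⟩ := exists_site_dist_le y hδ
  refine ⟨(x, 0), ?_⟩
  have hv : x ∈ hexFaceVertices (x, 0) := mem_hexFaceVertices_zero.2 (Or.inl rfl)
  have h1 := dist_triMeshPoint_hexCenter_le hv δ
  rw [abs_of_pos hδ, dist_comm] at h1
  calc dist ((δ : ℂ) * hexCenter (x, 0)) y
      ≤ dist ((δ : ℂ) * hexCenter (x, 0)) (triMeshPoint δ x) + dist (triMeshPoint δ x) y :=
        dist_triangle _ _ _
    _ ≤ δ + 2 * δ := add_le_add h1 hx
    _ = 3 * δ := by ring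

/-- **Finitely many face centres of `δ𝕋` lie in `closure Ω`** (`δ > 0`): `closure Ω` is bounded
and only finitely many faces have rescaled centre of norm `≤ ρ` (`finite_setOf_norm_hexCenter_le`).
[folklore] -/
private theorem finite_setOf_mem_closure_hexCenter (R : ConformalRectangle) {δ : ℝ} (hδ : 0 < δ) :
    {w : ℂ | w ∈ closure R.carrier ∧ ∃ F : HexVertex, w = (δ : ℂ) * hexCenter F}.Finite := by
  obtain ⟨ρ, hρ⟩ := (isBounded_iff_subset_closedBall (0 : ℂ)).1 R.isBounded.closure
  refine ((finite_setOf_norm_hexCenter_le hδ ρ).image (fun F => (δ : ℂ) * hexCenter F)).subset ?_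
  rintro w ⟨hw, F, rfl⟩
  refine ⟨F, ?_, rfl⟩
  have h := hρ hw
  rw [mem_closedBall, dist_zero_right] at h
  exact h

/-- **Face centres in `Ω` are eventually `η`-dense in `closure Ω`**: for every `η > 0`, for all
small `δ > 0`, every `z ∈ closure Ω` is within `η` of a face centre of `δ𝕋` lying in `Ω` (finite
cover of the compact `closure Ω` by balls `B(y, η/2)`, `y ∈ Ω`, a uniform radius `r` with
`B̄(y, r) ⊆ Ω`, and `3δ`-density of the face centres). [folklore] -/
private theorem eventually_forall_exists_hexCenter (R : ConformalRectangle) {η : ℝ} (hη : 0 < η) :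
    ∀ᶠ δ : ℝ in 𝓝[>] (0 : ℝ), ∀ z ∈ closure R.carrier, ∃ F : HexVertex,
      (δ : ℂ) * hexCenter F ∈ R.carrier ∧ dist z ((δ : ℂ) * hexCenter F) ≤ η := by
  have hK : IsCompact (closure R.carrier) := R.isBounded.isCompact_closure
  -- cover `closure Ω` by balls of radius `η/2` centred in `Ω`
  have hcover : closure R.carrier ⊆ ⋃ y : R.carrier, ball (y : ℂ) (η / 2) := by
    intro z hz
    obtain ⟨y, hy, hzy⟩ := Metric.mem_closure_iff.1 hz (η / 2) (by positivity)
    exact mem_iUnion.2 ⟨⟨y, hy⟩, mem_ball.2 hzy⟩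
  obtain ⟨T, hT⟩ :=
    hK.elim_finite_subcover (fun y : R.carrier => ball (y : ℂ) (η / 2)) (fun _ => isOpen_ball) hcover
  -- a uniform radius `r` with `closedBall y r ⊆ Ω` for the finitely many centres `y ∈ T`
  set T' : Set ℂ := ((↑) : R.carrier → ℂ) '' (T : Set R.carrier) with hT'
  have hT'fin : T'.Finite := T.finite_toSet.image _
  have hT'sub : T' ⊆ R.carrier := by
    rintro _ ⟨y, _, rfl⟩
    exact y.2
  obtain ⟨r, hr, hrΩ⟩ := hT'fin.isCompact.exists_cthickening_subset_open R.isOpen hT'sub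
  have hm : 0 < min r (η / 2) / 3 := by positivity
  filter_upwards [Ioc_mem_nhdsGT hm] with δ hδ
  intro z hz
  obtain ⟨y, hyT, hzy⟩ : ∃ y : R.carrier, y ∈ T ∧ dist z (y : ℂ) < η / 2 := by
    have h := hT hz
    simp only [mem_iUnion, mem_ball, exists_prop] at h
    exact h
  obtain ⟨F, hF⟩ := exists_hexCenter_dist_le (y : ℂ) hδ.1
  have h3 : 3 * δ ≤ min r (η / 2) := by linarith [hδ.2]
  refine ⟨F, ?_, ?_⟩
  · refine hrΩ (closedBall_subset_cthickening (show (y : ℂ) ∈ T' from ⟨y, hyT, rfl⟩) r ?_)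
    rw [mem_closedBall]
    exact hF.trans (h3.trans (min_le_left _ _))
  · calc dist z ((δ : ℂ) * hexCenter F)
        ≤ dist z y + dist ((δ : ℂ) * hexCenter F) y := dist_triangle_right _ _ _
      _ ≤ η / 2 + η / 2 := add_le_add hzy.le (hF.trans (h3.trans (min_le_right _ _)))
      _ = η := by ring

/-- **The face-centre grid** (stub `stub_voronoiGrid` of line `Sketch` for the crux `Target`,
stmt-CriticalPhenomena-6431; pure lattice geometry). For every conformal rectangle
`R = (Ω; a', b', c', d')` there is a family of finite sets `S_δ ⊆ ℂ` with: `S_δ ⊆ closure Ω`;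
for `δ > 0`, every face centre `δ · hexCenter F` of `δ𝕋` lying in `closure Ω` belongs to `S_δ`;
and `S_δ` is `ε(δ)`-dense in `closure Ω` for all small `δ > 0`, with `ε(δ) → 0` as `δ → 0⁺`.
Take `S_δ` = the (finite, `finite_setOf_mem_closure_hexCenter`) set of face centres of `δ𝕋` in
`closure Ω` for `δ > 0` and `∅` otherwise; density by `eventually_forall_exists_hexCenter` and the
infimum trick `exists_tendsto_of_forall_eventually`. This is the grid carrying Bollobás–Riordan's
discrete separating probabilities ((31), (34)). [cite: BollobasRiordan2006, Ch. 7 §7.2, pp. 196–197] -/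
theorem stub_voronoiGrid : ∀ R : ConformalRectangle, ∃ S : ℝ → Finset ℂ,
    (∀ δ, ∀ w ∈ S δ, w ∈ closure R.carrier) ∧
    (∀ δ : ℝ, 0 < δ → ∀ x : HexVertex,
      (δ : ℂ) * hexCenter x ∈ closure R.carrier → (δ : ℂ) * hexCenter x ∈ S δ) ∧
    ∃ ε : ℝ → ℝ, Tendsto ε (𝓝[>] 0) (𝓝 0) ∧
      ∀ᶠ δ in 𝓝[>] (0 : ℝ), ∀ z ∈ closure R.carrier, ∃ w ∈ S δ, dist z w ≤ ε δ := by
  intro R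
  classical
  set S : ℝ → Finset ℂ := fun δ =>
    if h : 0 < δ then (finite_setOf_mem_closure_hexCenter R h).toFinset else ∅ with hS
  have hmem : ∀ {δ : ℝ}, 0 < δ → ∀ w : ℂ,
      w ∈ S δ ↔ w ∈ closure R.carrier ∧ ∃ F : HexVertex, w = (δ : ℂ) * hexCenter F := by
    intro δ hδ w
    simp only [hS, dif_pos hδ, Set.Finite.mem_toFinset, mem_setOf_eq]
  refine ⟨S, ?_, ?_, ?_⟩
  · intro δ w hw
    by_cases hδ : 0 < δ
    · exact ((hmem hδ w).1 hw).1
    · simp [hS, dif_neg hδ] at hw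
  · intro δ hδ x hx
    exact (hmem hδ _).2 ⟨hx, x, rfl⟩
  · obtain ⟨ε, hε, hev⟩ := exists_tendsto_of_forall_eventually
      (P := fun δ η => ∀ z ∈ closure R.carrier, ∃ w ∈ S δ, dist z w ≤ η) fun η hη => by
        filter_upwards [eventually_forall_exists_hexCenter R hη, self_mem_nhdsWithin]
          with δ hδ hpos
        intro z hz
        obtain ⟨F, hFΩ, hdist⟩ := hδ z hz
        exact ⟨_, (hmem hpos _).2 ⟨subset_closure hFΩ, F, rfl⟩, hdist⟩
    exact ⟨ε, hε, hev.mono fun δ hδ => hδ.2⟩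

end Summit.CriticalPhenomena.CardyFormulaZ2.Theorems.CardyFlipRussoTarget
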